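import Literature.NumberTheory.ModularForms.ThetaNullRelationLevelThree
import Literature.NumberTheory.ModularForms.SiegelThetaSeriesThetaDuplication
import Literature.NumberTheory.ModularForms.SiegelThetaSeriesHexagonalLattice
import HarnessLib

/-!
# Product relations among the thetanulls: `θ₂(z)θ₃(z) = ½θ₂(z/2)²` ((24)), `θ₂(z)θ₃(3z) + θ₃(z)θ₂(3z) =
# ½θ₂(z/4)θ₂(3z/4)` ((28)), `θ₂(z)θ₂(3z) + θ₃(z)θ₃(3z) = ½{θ₃(z/4)θ₃(3z/4) + θ₄(z/4)θ₄(3z/4)}` ((29)), and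
# `Θ_hex(2τ) = ½(θ₃(τ)θ₃(3τ) + θ₄(τ)θ₄(3τ))` (Conway–Sloane Ch. 4 §4.1, §6.2)

Layer `Literature/NumberTheory/ModularForms`, namespace `Literature.NumberTheory.ModularForms` (lane
`lit-hodgefound`, Layer A4, theta-divisor row A4-17; prover seat `lit-hodgefound-p23`, row «A4-17(bb)»; sequel of
`ThetaNullRelationLevelThree.lean` ((27): `θ₂θ₂(3z) = θ₃θ₃(3z) − θ₄θ₄(3z)`), `SiegelThetaSeriesThetaDuplication.lean`
((22): `θ₃(τ) = θ₃(4τ) + θ₂(4τ)`, `θ₄(τ) = θ₃(4τ) − θ₂(4τ)`) and `SiegelThetaSeriesHexagonalLattice.lean` ((60):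
`θ¹((τ), A 2) = θ₃(2τ)θ₃(6τ) + θ₂(2τ)θ₂(6τ)`), in the vocabulary of
`Literature/NumberTheory/EllipticCurves/JacobiThetaDerivativeFormula.lean` (`theta2 theta3 theta4 : ℂ → ℂ`) and
`Literature/Algebra/EuclideanLattices/IntegerLatticeTheta.lean` (`Σ_k e^{πiτk²} = theta3 τ`, `Σ_k e^{πiτ(k+½)²} =
theta2 τ`)).

Source followed (held text, read at the quoted chunk).

* J. H. Conway, N. J. A. Sloane, *Sphere Packings, Lattices and Groups* (3rd ed. 1999; held
  `book:conway1999-sphere-packings-lattices-groups`), Ch. 4 §4.1 [p0211 L30–L42]: **(24)** `θ₂(z)θ₃(z) = ½θ₂(z/2)²`,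
  `θ₃(z)θ₄(z) = θ₄(2z)²` (the latter is the tree's `Literature.Analysis.SpecialFunctions.theta4_two_mul_sq`, not
  restated); **(28)** `θ₂(z)θ₃(3z) + θ₃(z)θ₂(3z) = ½θ₂(z/4)θ₂(3z/4)`; **(29)** `θ₂(z)θ₂(3z) + θ₃(z)θ₃(3z) =
  ½{θ₃(z/4)θ₃(3z/4) + θ₄(z/4)θ₄(3z/4)}`; §6.2 (60) [p0218 L40]: `Θ_hex(z) = θ₃(z)θ₃(3z) + θ₂(z)θ₂(3z)`.

The book lists (24), (28), (29) without proof. Here: (24) by the substitution `ℤ² = {a+b even} ⊔ {a+b odd}`,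
`(a, b) = (r+s, r−s)` resp. `(r+s, r−s−1)`, under which `(a+½)² + (b+½)² = 2(r+½)² + 2s²` resp. `2r² + 2(s+½)²`;
(29) from (22) at `τ` and `3τ` (`(A+B)(C+D) + (A−B)(C−D) = 2(AC + BD)`); (28) from (27) and (22)
(`(A+B)(C+D) − (A−B)(C−D) = 2(AD + BC)`); all written at `z = 2τ` resp. `z = 4τ` to stay inside `ℍ` without halving.

## What is here (everything is a theorem; no definition, no named fact, net debt `0`)

* §1 **`theta2_sq_eq_two_mul : θ₂(τ)² = 2θ₂(2τ)θ₃(2τ)`** (= (24) at `z = 2τ`).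
* §2 **`theta3_mul_add_theta4_mul : θ₃(τ)θ₃(3τ) + θ₄(τ)θ₄(3τ) = 2(θ₃(4τ)θ₃(12τ) + θ₂(4τ)θ₂(12τ))`** (= (29) at
  `z = 4τ`), **`theta2_mul_theta3_add : θ₂(4τ)θ₃(12τ) + θ₃(4τ)θ₂(12τ) = ½θ₂(τ)θ₂(3τ)`** (= (28) at `z = 4τ`),
  and **`siegelThetaSeries_cartanMatrixA_two_one1_two_mul : θ¹((2τ), CartanMatrix.A 2) = ½(θ₃(τ)θ₃(3τ) +
  θ₄(τ)θ₄(3τ))`** ((60) combined with (29): the hexagonal theta series at `2τ`).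

Not here: `θ₂(z)θ₄(z) = (2√i)⁻¹θ₂((z+1)/2)²` ((24), third), (30)–(31) (`θ₁'`).

## References

* [ConwaySloane1999] J. H. Conway, N. J. A. Sloane, *Sphere Packings, Lattices and Groups*, 3rd ed., Springer
  (1999), Ch. 4 §4.1 (24), (28), (29) (pp. 104–105), §6.2 (60) (p. 111) (held chunks p0211, p0218).
-/

noncomputable section

open Complex Real Finset Filter Topology Set
open scoped UpperHalfPlane
open Literature.NumberTheory.EllipticCurves.JacobiThetaNull (theta2 theta3 theta4)
open Literature.Algebra.EuclideanLattices (summable_norm_cexp_pi_I_mul_add_sq tsum_cexp_pi_I_mul_sq_eq_theta3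
  tsum_cexp_pi_I_mul_add_half_sq_eq_theta2)
open Literature.NumberTheory.ModularForms.SiegelUpperHalfSpace

namespace Literature.NumberTheory.ModularForms

open SiegelModularForm

/-! ### §0 Plumbing -/

section Plumbing

/-- `Im(cτ) = c·Im τ > 0` for a positive numeral `c`. [cite: ConwaySloane1999, Ch. 4 §4.1 ("Im(z) > 0") (p0210)] -/
private theorem im_natCast_mul_pos'' (c : ℕ) (hc : 0 < c) (τ : ℍ) : 0 < ((c : ℂ) * (τ : ℂ)).im := by
  rw [show (c : ℂ) * τ = ((c : ℝ) : ℂ) * τ by push_cast; ring, Complex.im_ofReal_mul]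
  exact mul_pos (by exact_mod_cast hc) τ.im_pos

/-- `Σ_k |e^{πiσk²}| < ∞` for `Im σ > 0`. [cite: ConwaySloane1999, Ch. 4 §4.1 (9) (p0210)] -/
private theorem summable_norm_sq'' {σ : ℂ} (hσ : 0 < σ.im) :
    Summable fun k : ℤ => ‖cexp ((π : ℂ) * I * σ * (((k : ℝ) ^ 2 : ℝ) : ℂ))‖ :=
  (summable_norm_cexp_pi_I_mul_add_sq hσ 0).congr fun k => by rw [add_zero]

/-- `θ₂(σ)² = Σ_{(a,b)} e^{πiσ(a+½)²} e^{πiσ(b+½)²}` (`Θ_{ℤ²+(½,½)} = θ₂²`), `Im σ > 0`.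
[cite: ConwaySloane1999, Ch. 4 §4.1 (8) (p0210), §5 (44) (p0212)] -/
private theorem theta2_sq_eq_tsum {σ : ℂ} (hσ : 0 < σ.im) :
    theta2 σ ^ 2 = ∑' p : ℤ × ℤ, cexp ((π : ℂ) * I * σ * ((((p.1 : ℝ) + 1 / 2) ^ 2 : ℝ) : ℂ)) *
      cexp ((π : ℂ) * I * σ * ((((p.2 : ℝ) + 1 / 2) ^ 2 : ℝ) : ℂ)) := by
  rw [sq, ← tsum_cexp_pi_I_mul_add_half_sq_eq_theta2, tsum_mul_tsum_of_summable_norm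
    (summable_norm_cexp_pi_I_mul_add_sq hσ (1 / 2)) (summable_norm_cexp_pi_I_mul_add_sq hσ (1 / 2))]

/-- `θ₂(σ)θ₃(σ) = Σ_{(r,s)} e^{πiσ(r+½)²} e^{πiσs²}`, `Im σ > 0`. [cite: ConwaySloane1999, Ch. 4 §4.1 (8)–(9) (p0210)] -/
private theorem theta2_mul_theta3_eq_tsum {σ : ℂ} (hσ : 0 < σ.im) :
    theta2 σ * theta3 σ = ∑' p : ℤ × ℤ, cexp ((π : ℂ) * I * σ * ((((p.1 : ℝ) + 1 / 2) ^ 2 : ℝ) : ℂ)) *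
      cexp ((π : ℂ) * I * σ * (((p.2 : ℝ) ^ 2 : ℝ) : ℂ)) := by
  rw [← tsum_cexp_pi_I_mul_add_half_sq_eq_theta2, ← tsum_cexp_pi_I_mul_sq_eq_theta3,
    tsum_mul_tsum_of_summable_norm (summable_norm_cexp_pi_I_mul_add_sq hσ (1 / 2)) (summable_norm_sq'' hσ)]

/-- `θ₃(σ)θ₂(σ) = Σ_{(r,s)} e^{πiσr²} e^{πiσ(s+½)²}`, `Im σ > 0`. [cite: ConwaySloane1999, Ch. 4 §4.1 (8)–(9) (p0210)] -/
private theorem theta3_mul_theta2_eq_tsum {σ : ℂ} (hσ : 0 < σ.im) :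
    theta3 σ * theta2 σ = ∑' p : ℤ × ℤ, cexp ((π : ℂ) * I * σ * (((p.1 : ℝ) ^ 2 : ℝ) : ℂ)) *
      cexp ((π : ℂ) * I * σ * ((((p.2 : ℝ) + 1 / 2) ^ 2 : ℝ) : ℂ)) := by
  rw [← tsum_cexp_pi_I_mul_add_half_sq_eq_theta2, ← tsum_cexp_pi_I_mul_sq_eq_theta3,
    tsum_mul_tsum_of_summable_norm (summable_norm_sq'' hσ) (summable_norm_cexp_pi_I_mul_add_sq hσ (1 / 2))]

/-- The splitting `ℤ² = {a + b even} ⊔ {a + b odd}`: `(r, s) ↦ (r + s, r − s)` resp. `(r + s, r − s − 1)`.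
[cite: ConwaySloane1999, Ch. 4 §6.2 (60) ("putting `r = …, s = …`") (p0218)] -/
private theorem exists_sumDiff_equiv'' :
    ∃ e : (ℤ × ℤ) ⊕ (ℤ × ℤ) ≃ ℤ × ℤ, (∀ p, (e (Sum.inl p)).1 = p.1 + p.2 ∧ (e (Sum.inl p)).2 = p.1 - p.2) ∧
      ∀ p, (e (Sum.inr p)).1 = p.1 + p.2 ∧ (e (Sum.inr p)).2 = p.1 - p.2 - 1 := by
  refine ⟨⟨Sum.elim (fun p => (p.1 + p.2, p.1 - p.2)) (fun p => (p.1 + p.2, p.1 - p.2 - 1)),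
    fun q => if (q.1 + q.2) % 2 = 0 then Sum.inl ((q.1 + q.2) / 2, (q.1 - q.2) / 2)
      else Sum.inr ((q.1 + q.2 + 1) / 2, (q.1 - q.2 - 1) / 2), ?_, ?_⟩, fun p => ⟨rfl, rfl⟩, fun p => ⟨rfl, rfl⟩⟩
  · rintro (⟨r, s⟩ | ⟨r, s⟩)
    · dsimp only [Sum.elim_inl]
      rw [if_pos (by omega)]
      exact congrArg Sum.inl (Prod.ext (by dsimp only; omega) (by dsimp only; omega))
    · dsimp only [Sum.elim_inr]
      rw [if_neg (by omega)]
      exact congrArg Sum.inr (Prod.ext (by dsimp only; omega) (by dsimp only; omega))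
  · rintro ⟨a, b⟩
    dsimp only
    split_ifs with h
    · rw [Sum.elim_inl]
      exact Prod.ext (by dsimp only; omega) (by dsimp only; omega)
    · rw [Sum.elim_inr]
      exact Prod.ext (by dsimp only; omega) (by dsimp only; omega)

/-- `(a+½)² + (b+½)² = 2(r+½)² + 2s²` for `(a, b) = (r+s, r−s)`, in the exponent. [cite: ConwaySloane1999, Ch. 4 §4.1 (24) (p0211)] -/
private theorem halfSq_inl (τ : ℂ) (r s : ℤ) :
    cexp ((π : ℂ) * I * τ * (((((r + s : ℤ) : ℝ) + 1 / 2) ^ 2 : ℝ) : ℂ)) *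
        cexp ((π : ℂ) * I * τ * (((((r - s : ℤ) : ℝ) + 1 / 2) ^ 2 : ℝ) : ℂ)) =
      cexp ((π : ℂ) * I * (2 * τ) * ((((r : ℝ) + 1 / 2) ^ 2 : ℝ) : ℂ)) *
        cexp ((π : ℂ) * I * (2 * τ) * (((s : ℝ) ^ 2 : ℝ) : ℂ)) := by
  rw [← Complex.exp_add, ← Complex.exp_add]
  congr 1
  push_cast
  ring

/-- `(a+½)² + (b+½)² = 2r² + 2(s+½)²` for `(a, b) = (r+s, r−s−1)`, in the exponent. [cite: ConwaySloane1999, Ch. 4 §4.1 (24) (p0211)] -/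
private theorem halfSq_inr (τ : ℂ) (r s : ℤ) :
    cexp ((π : ℂ) * I * τ * (((((r + s : ℤ) : ℝ) + 1 / 2) ^ 2 : ℝ) : ℂ)) *
        cexp ((π : ℂ) * I * τ * (((((r - s - 1 : ℤ) : ℝ) + 1 / 2) ^ 2 : ℝ) : ℂ)) =
      cexp ((π : ℂ) * I * (2 * τ) * (((r : ℝ) ^ 2 : ℝ) : ℂ)) *
        cexp ((π : ℂ) * I * (2 * τ) * ((((s : ℝ) + 1 / 2) ^ 2 : ℝ) : ℂ)) := by
  rw [← Complex.exp_add, ← Complex.exp_add]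
  congr 1
  push_cast
  ring

end Plumbing

/-! ### §1 (24): `θ₂(τ)² = 2θ₂(2τ)θ₃(2τ)` -/

section TwentyFour

/-- **Conway–Sloane (24), first relation: `θ₂(z)θ₃(z) = ½θ₂(z/2)²`**, i.e. `θ₂(τ)² = 2θ₂(2τ)θ₃(2τ)` (`z = 2τ`):
split `θ₂(τ)² = Σ_{(a,b)} q^{(a+½)²+(b+½)²}` by the parity of `a + b`; both halves equal `θ₂(2τ)θ₃(2τ)`.
[cite: ConwaySloane1999, Ch. 4 §4.1 (24) (p0211)] -/
theorem theta2_sq_eq_two_mul (τ : ℍ) :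
    theta2 (τ : ℂ) ^ 2 = 2 * theta2 (2 * (τ : ℂ)) * theta3 (2 * (τ : ℂ)) := by
  have h2 := im_natCast_mul_pos'' 2 (by norm_num) τ
  push_cast at h2
  obtain ⟨e, he₁, he₂⟩ := exists_sumDiff_equiv''
  have hS1 : Summable fun p : ℤ × ℤ => cexp ((π : ℂ) * I * (2 * (τ : ℂ)) * ((((p.1 : ℝ) + 1 / 2) ^ 2 : ℝ) : ℂ)) *
      cexp ((π : ℂ) * I * (2 * (τ : ℂ)) * (((p.2 : ℝ) ^ 2 : ℝ) : ℂ)) := by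
    have h := summable_mul_of_summable_norm (summable_norm_cexp_pi_I_mul_add_sq h2 (1 / 2)) (summable_norm_sq'' h2)
    exact h
  have hS2 : Summable fun p : ℤ × ℤ => cexp ((π : ℂ) * I * (2 * (τ : ℂ)) * (((p.1 : ℝ) ^ 2 : ℝ) : ℂ)) *
      cexp ((π : ℂ) * I * (2 * (τ : ℂ)) * ((((p.2 : ℝ) + 1 / 2) ^ 2 : ℝ) : ℂ)) := by
    have h := summable_mul_of_summable_norm (summable_norm_sq'' h2) (summable_norm_cexp_pi_I_mul_add_sq h2 (1 / 2))
    exact h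
  rw [mul_assoc, two_mul, theta2_sq_eq_tsum τ.im_pos, ← e.tsum_eq, Summable.tsum_sum]
  · congr 1
    · rw [theta2_mul_theta3_eq_tsum h2]
      exact tsum_congr fun p => by rw [(he₁ p).1, (he₁ p).2]; exact halfSq_inl (τ : ℂ) p.1 p.2
    · rw [mul_comm (theta2 (2 * (τ : ℂ))) (theta3 (2 * (τ : ℂ))), theta3_mul_theta2_eq_tsum h2]
      exact tsum_congr fun p => by rw [(he₂ p).1, (he₂ p).2]; exact halfSq_inr (τ : ℂ) p.1 p.2
  · refine hS1.congr fun p => ?_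
    change _ = cexp ((π : ℂ) * I * (τ : ℂ) * (((((e (Sum.inl p)).1 : ℝ) + 1 / 2) ^ 2 : ℝ) : ℂ)) *
      cexp ((π : ℂ) * I * (τ : ℂ) * (((((e (Sum.inl p)).2 : ℝ) + 1 / 2) ^ 2 : ℝ) : ℂ))
    rw [(he₁ p).1, (he₁ p).2, halfSq_inl]
  · refine hS2.congr fun p => ?_
    change _ = cexp ((π : ℂ) * I * (τ : ℂ) * (((((e (Sum.inr p)).1 : ℝ) + 1 / 2) ^ 2 : ℝ) : ℂ)) *
      cexp ((π : ℂ) * I * (τ : ℂ) * (((((e (Sum.inr p)).2 : ℝ) + 1 / 2) ^ 2 : ℝ) : ℂ))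
    rw [(he₂ p).1, (he₂ p).2, halfSq_inr]

end TwentyFour

/-! ### §2 (28), (29), and the hexagonal theta series at `2τ` -/

section TwentyEightNine

/-- **Conway–Sloane (29): `θ₂(z)θ₂(3z) + θ₃(z)θ₃(3z) = ½{θ₃(z/4)θ₃(3z/4) + θ₄(z/4)θ₄(3z/4)}`** at `z = 4τ`:
`θ₃(τ)θ₃(3τ) + θ₄(τ)θ₄(3τ) = 2(θ₃(4τ)θ₃(12τ) + θ₂(4τ)θ₂(12τ))` (from (22) at `τ` and `3τ`:
`(A+B)(C+D) + (A−B)(C−D) = 2(AC + BD)`). [cite: ConwaySloane1999, Ch. 4 §4.1 (22), (29) (p0211)] -/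
theorem theta3_mul_add_theta4_mul (τ : ℍ) :
    theta3 (τ : ℂ) * theta3 (3 * (τ : ℂ)) + theta4 (τ : ℂ) * theta4 (3 * (τ : ℂ)) =
      2 * (theta3 (4 * (τ : ℂ)) * theta3 (12 * (τ : ℂ)) + theta2 (4 * (τ : ℂ)) * theta2 (12 * (τ : ℂ))) := by
  have h3 := im_natCast_mul_pos'' 3 (by norm_num) τ
  push_cast at h3
  have hA := theta3_eq_theta3_add_theta2 τ
  have hB := theta4_eq_theta3_sub_theta2 τ
  have hC := theta3_eq_theta3_add_theta2 (UpperHalfPlane.mk (3 * (τ : ℂ)) h3)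
  have hD := theta4_eq_theta3_sub_theta2 (UpperHalfPlane.mk (3 * (τ : ℂ)) h3)
  rw [UpperHalfPlane.coe_mk, show (4 : ℂ) * (3 * (τ : ℂ)) = 12 * (τ : ℂ) by ring] at hC hD
  rw [hA, hB, hC, hD]
  ring

/-- **Conway–Sloane (28): `θ₂(z)θ₃(3z) + θ₃(z)θ₂(3z) = ½θ₂(z/4)θ₂(3z/4)`** at `z = 4τ`:
`θ₂(4τ)θ₃(12τ) + θ₃(4τ)θ₂(12τ) = ½θ₂(τ)θ₂(3τ)` (from (27) and (22): `(A+B)(C+D) − (A−B)(C−D) = 2(AD + BC)`).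
[cite: ConwaySloane1999, Ch. 4 §4.1 (22), (27), (28) (p0211)] -/
theorem theta2_mul_theta3_add (τ : ℍ) :
    theta2 (4 * (τ : ℂ)) * theta3 (12 * (τ : ℂ)) + theta3 (4 * (τ : ℂ)) * theta2 (12 * (τ : ℂ)) =
      theta2 (τ : ℂ) * theta2 (3 * (τ : ℂ)) / 2 := by
  have h3 := im_natCast_mul_pos'' 3 (by norm_num) τ
  push_cast at h3
  have h27 := theta2_mul_theta2_three_mul τ
  have hA := theta3_eq_theta3_add_theta2 τ
  have hB := theta4_eq_theta3_sub_theta2 τ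
  have hC := theta3_eq_theta3_add_theta2 (UpperHalfPlane.mk (3 * (τ : ℂ)) h3)
  have hD := theta4_eq_theta3_sub_theta2 (UpperHalfPlane.mk (3 * (τ : ℂ)) h3)
  rw [UpperHalfPlane.coe_mk, show (4 : ℂ) * (3 * (τ : ℂ)) = 12 * (τ : ℂ) by ring] at hC hD
  rw [h27, hA, hB, hC, hD]
  ring

/-- **The hexagonal theta series at `2τ`**: `θ¹((2τ), CartanMatrix.A 2) = ½(θ₃(τ)θ₃(3τ) + θ₄(τ)θ₄(3τ))`
((60) `Θ_hex(z) = θ₃(z)θ₃(3z) + θ₂(z)θ₂(3z)` at `z = 4τ`, combined with (29)).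
[cite: ConwaySloane1999, Ch. 4 §6.2 (60) (p0218), §4.1 (29) (p0211)] -/
theorem siegelThetaSeries_cartanMatrixA_two_one1_two_mul (τ : ℍ) :
    siegelThetaSeries (CartanMatrix.A 2) (one1 (2 * (τ : ℂ))) =
      (theta3 (τ : ℂ) * theta3 (3 * (τ : ℂ)) + theta4 (τ : ℂ) * theta4 (3 * (τ : ℂ))) / 2 := by
  have h2 := im_natCast_mul_pos'' 2 (by norm_num) τ
  push_cast at h2
  have h60 := siegelThetaSeries_cartanMatrixA_two_one1 (UpperHalfPlane.mk (2 * (τ : ℂ)) h2)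
  rw [UpperHalfPlane.coe_mk, show (2 : ℂ) * (2 * (τ : ℂ)) = 4 * (τ : ℂ) by ring,
    show (6 : ℂ) * (2 * (τ : ℂ)) = 12 * (τ : ℂ) by ring] at h60
  rw [h60, theta3_mul_add_theta4_mul]
  ring

end TwentyEightNine

end Literature.NumberTheory.ModularForms

end
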